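import Summits.BirchSwinnertonDyer.BirchSwinnertonDyer.Theorems.KimAtThreeShallowEqDeepAnomalousCongruenceOfZetaBody
import Summits.BirchSwinnertonDyer.BirchSwinnertonDyer.Theorems.KimAtThreeShallowEqDeepAnomalousValueRow
import Summits.BirchSwinnertonDyer.Rank1Residual.GaloisImage.KatoKuriharaValueRowsOfZetaBody
import HarnessLib

/-!
# Route `KimAtThreeKolyvagin` (W2): the per-level VALUE ROWS of the Kato–Kurihara port ON THE TWISTED LATTICE,
# from `ZetaBody`, at a GOOD prime `p ∤ A·N` of the curve — the anomalous rows' T-PK6-VDIS (file 5)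

Cell `bsd-addord`, seat `bsd-addord-w2-c4` (gen 9; owner of crux 19599 `ShallowEqDeepOffKatoStratum`, item
19077 `ShallowEqDeepAtTorsionFree`).  `--supports` 19599.  HONEST FRAMING: ONE END-TYPE TOOL THEOREM with
displayed hypotheses (no definition, no named fact, no instance, no `sorry`); Kato's cited matrix `ZetaBody`
enters as the displayed HYPOTHESIS `hbody` (never obtained); nothing is booked; 19599 / 19077 / 19560 stay OPEN;
BSD is not proved by any of this.  Credit: n1011-p02's T-PK6-VDIS `ValueRow.valueRow_of_zetaBody` — this file
is that theorem's proof VERBATIM (embedding unit, avatar, units mod `n`, Stevens integrality, the twist lift and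
its unit certificate BY NAME: `exists_padicLift_twist`, `isUnit_sum_coeff_twist_of_certificates` with depletion
modulus `A`) followed by the seat's FACTORED congruence and twisted ★★ instead of p15's congruence and p02's ★★.

## What

★★ `valueRow_twist_of_zetaBody`: at a prime `p ∤ A`, `p ∤ N` (GOOD reduction of the curve at `p`; the
multiplicative rows are gen 8's `KimAtThreeShallowEqDeepValueRowsNonAdd`), from `hbody : ZetaBody W p f ι κ Λ c d a A z x`
and the displayed guards of T-PK6-VDIS with TWO edits — `p² ∣ N` is replaced by `p ∤ A ∧ p ∤ N`, and END-m1's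
depletion certificate is taken AWAY FROM `p`: `v_p(∏_{q∣A}(1 − a_q/q + 𝟙_{q∤N}/q)) = 0` (NO condition on
`#Ẽ(𝔽_p) = p + 1 − a_p`: the ANOMALOUS case `p ∣ #Ẽ(𝔽_p)` is allowed) — the value row at `(j, σ, r)` ON THE
TWISTED LATTICE: `∃ v ([p]·v = 1), ∃ s u ψ, (ψ onto) ∧ [∃ l ∈ L_int, (p : ℤ_p) • (1 ⊗ 𝔇^{field}(x + σ₋₁x))
− (s·(p − a_p + 1)) ⊗ 1 = p^{j+1} • Σ_g P_g • (1 ⊗ σ_g) l] ∧ s̄ = u·p⁰·δ̃_n`, `P = p − a_pδ_v + δ_{v²}` (`v = [p]⁻¹`,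
so `δ_v ↔ σ_p⁻¹`: the `p`-Euler factor `p·E_p(σ_p⁻¹)` of Kato's depleted value, n1011's `E_q` at `q = p`).
This is LITERALLY the premise of the anomalous rider's scalar clause (sequel `KimAtThreeShallowEqDeepAnomalousRider`)
with `s·#Ẽ(𝔽_p)` as the displayed scalar — the functional `exp*_ω/E_p(1)` returns `s̄ = u·δ̃_n`: no digit lost.
WHY the twisted lattice is the right one: the seat's lattice lemma (module docstring of
`KimAtThreeShallowEqDeepAnomalousCongruence`): `exp*_ω(H¹(K,T)) = E_p(φ⁻¹)·𝓞_K` for unramified `K/ℚ_p` with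
`E(K)[p] = 0` (true at every tame level of a good anomalous `t = 0` row).
HONEST LIMITS: closes nothing by itself (TOOL); books nothing; additive `p` is n1011's original T-PK6-VDIS,
multiplicative `p` gen 8's scaled one.

References: K. Kato, Astérisque 295 (2004) Thm. 6.6 (1) p. 163, §6.2 p. 161, Thm. 9.7 p. 189
[Kato2004Asterisque]; C.-H. Kim, AJM 148 (2026) = arXiv:2203.12159, §1.4.1, Lemma 3.4, §3.4–3.5 and the
proof of Thm. 3.13 [Kim2022StructureSelmer]; B. Mazur, J. Tate, J. Teitelbaum, Invent. Math. 84 (1986) §I.8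
[MazurTateTeitelbaum1986Invent]; K. Rubin, *Euler Systems* (2000) §4.4 [Rubin2000].
-/

noncomputable section

-- the Theorems namespace of a single-conjunct summit repeats the summit name by design (D-0017)
set_option linter.dupNamespace false

open scoped BigOperators NumberField TensorProduct
open Finset IsDedekindDomain NumberField Field WeierstrassCurve Rat.HeightOneSpectrum MonoidAlgebra
open Literature.NumberTheory.GaloisRepresentations Literature.NumberTheory.GaloisCohomology
open Literature.NumberTheory.EllipticCurves Literature.NumberTheory.EllipticCurves.ModularForms
open Literature.NumberTheory.EllipticCurves.Kato2004
open Literature.NumberTheory.EllipticCurves.Kato2004.EulerSystemValues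
open Summit.BirchSwinnertonDyer.Rank1Residual.GaloisImage
open Summit.BirchSwinnertonDyer.Rank1Residual.GaloisImage.ValueRow

namespace Summit.BirchSwinnertonDyer.BirchSwinnertonDyer.Theorems.KimAtThreeShallowEqDeepAnomalousValueRowsOfZetaBody

section Main

variable {W : WeierstrassCurve ℚ} [W.IsElliptic] [W.IsGloballyMinimal] {p : ℕ} [Fact p.Prime]
  [ContinuousSMul ℤ_[p] (W.tateModule p)] [Module.Free ℤ_[p] (W.tateModule p)]
  [Module.Finite ℤ_[p] (W.tateModule p)] {N : ℕ} [NeZero N] {f : CuspForm (CongruenceSubgroup.Gamma0 N) 2}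
  {ι : (m : ℕ) → (CyclotomicField m ℚ →+* ℂ)} {κ : ℝ}
  {Λ : ∀ (k : ℕ) (r : Finset (HeightOneSpectrum (𝓞 ℚ))),
    H1 (tateRep W p) (cycSubgroup p k r) →ₗ[ℤ_[p]] ℚ_[p] ⊗[ℚ] CyclotomicField (cycLevel p k r) ℚ}
  {c d a : ℤ} {A : ℕ} [NeZero A]
  {z : ∀ (k : ℕ) (r : (cyclotomicLevelsRat p (badPlaces c d A N)).Ideals),
    H1 (tateRep W p) ((cyclotomicLevelsRat p (badPlaces c d A N)).level k r.1)}
  {x : ∀ (k : ℕ) (r : (cyclotomicLevelsRat p (badPlaces c d A N)).Ideals),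
    CyclotomicField (cycLevel p k r.1) ℚ}

set_option backward.isDefEq.respectTransparency false in
/-- **★★ THE VALUE ROW at `(j, σ, r)` ON THE TWISTED LATTICE, FROM `ZetaBody`, at a good `p ∤ A·N`**
(module docstring): n1011's T-PK6-VDIS with the `p`-Euler factor `P = p − a_pδ_{[p]⁻¹} + δ_{[p]⁻²}` moved to
the LATTICE side; the depletion certificate is taken away from `p` (anomalous `p` allowed).
[cite: Kim2022StructureSelmer, §1.4.1, Lemma 3.4, §3.4.1–§3.5 and the proof of Thm. 3.13 (arXiv v3 pp. 7, 16, 26–28; = Thm. 3.11 of AJM 148)]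
[cite: Kato2004Asterisque, Thm. 6.6 (1) (p. 163), §6.2 (p. 161) and Thm. 9.7 (p. 189)]
[cite: MazurTateTeitelbaum1986Invent, §I.8] -/
theorem valueRow_twist_of_zetaBody
    (hbody : ZetaBody W p f ι κ Λ c d a A z x) (hf : IsNewformOf W f) (hp2 : p ≠ 2)
    (hirr : W.HasIrreducibleModPGaloisRep p)
    (hNorm : ∃ u : ℚ, (u : ℝ) = κ ∧ padicValRat p u = 0) (hκ0 : κ ≠ 0)
    (d' : ℤ) (hcd : Int.gcd (c * d) A = 1) (hdd' : d * d' ≡ 1 [ZMOD (A : ℤ)])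
    (hAN : Nat.Coprime A N) (hpA : ¬ p ∣ A) (hpN : ¬ p ∣ N)
    (aM : ℕ → ℤ) (haM : ∀ q ∈ (p * A).primeFactors, cuspCoeff f q = aM q)
    -- the depletion certificate AWAY FROM `p`: `v_p(∏_{q ∣ A}(1 − a_q/q + 𝟙_{q∤N}/q)) = 0`
    (hE0 : ∏ q ∈ A.primeFactors, (1 - (aM q : ℚ) / q + (if q ∣ N then 0 else (1 / q : ℚ))) ≠ 0)
    (hE : padicValRat p
      (∏ q ∈ A.primeFactors, (1 - (aM q : ℚ) / q + (if q ∣ N then 0 else (1 / q : ℚ)))) = 0)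
    (hR0 : (c : ℚ) ^ 2 * (d : ℚ) ^ 2 * ratMinusSymbol f ((a : ℚ) / A) -
        (c : ℚ) * (d : ℚ) ^ 2 * ratMinusSymbol f ((a * c : ℚ) / A) -
        (c : ℚ) ^ 2 * (d : ℚ) * ratMinusSymbol f ((a * d' : ℚ) / A) +
        (c : ℚ) * (d : ℚ) * ratMinusSymbol f ((a * c * d' : ℚ) / A) ≠ 0)
    (hR : padicValRat p ((c : ℚ) ^ 2 * (d : ℚ) ^ 2 * ratMinusSymbol f ((a : ℚ) / A) -
        (c : ℚ) * (d : ℚ) ^ 2 * ratMinusSymbol f ((a * c : ℚ) / A) -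
        (c : ℚ) ^ 2 * (d : ℚ) * ratMinusSymbol f ((a * d' : ℚ) / A) +
        (c : ℚ) * (d : ℚ) * ratMinusSymbol f ((a * c * d' : ℚ) / A)) = 0)
    (η : (q : HeightOneSpectrum (𝓞 ℚ)) → (ZMod (Ideal.absNorm q.asIdeal))ˣ)
    (j : ℕ) (σ : HeightOneSpectrum (𝓞 ℚ) → absoluteGaloisGroup ℚ)
    (hσI : ∀ q, σ q ∈ (adicCompletionPrime ℚ q).inertia (absoluteGaloisGroup ℚ))
    (hσχ : ∀ q, modNCyclotomicCharacter ℚ (Ideal.absNorm q.asIdeal) (σ q) = η q)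
    (r : Finset (HeightOneSpectrum (𝓞 ℚ)))
    (hr : ∀ q ∈ r, q ∈ (cyclotomicLevelsRat p (badPlaces c d A N)).primes)
    (hKol : ∀ q ∈ r, Kato.IsKolyvaginPrime W p (j + 1) ((primesEquiv q : Nat.Primes) : ℕ))
    (hη : ∀ q ∈ r, Subgroup.zpowers (η q) = ⊤) :
    ∃ (v : (ZMod (cycLevel p 0 r))ˣ), (v : ZMod (cycLevel p 0 r)) * (p : ZMod (cycLevel p 0 r)) = 1 ∧
    ∃ (s : ℤ_[p]) (u : (ZMod (p ^ (j + 1)))ˣ)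
      (ψ : (ℓ : ℕ) → (ZMod ℓ)ˣ →* Multiplicative (ZMod (p ^ (j + 1)))),
      (∀ q ∈ r, Function.Surjective (ψ (Ideal.absNorm q.asIdeal))) ∧
      (∃ l ∈ cycIntLattice p (cycLevel p 0 r),
        (p : ℤ_[p]) • ((1 : ℚ_[p]) ⊗ₜ[ℚ]
          ((r.noncommProd (fun ℓ : HeightOneSpectrum (𝓞 ℚ) =>
              ∑ j ∈ Finset.range (((primesEquiv ℓ : Nat.Primes) : ℕ) - 1),
                (j : Module.End ℚ (CyclotomicField (cycLevel p 0 r) ℚ)) *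
                  (sigma (cycLevel p 0 r) (modNCyclotomicCharacter ℚ (cycLevel p 0 r) (σ ℓ)) :
                    CyclotomicField (cycLevel p 0 r) ℚ →ₐ[ℚ]
                      CyclotomicField (cycLevel p 0 r) ℚ).toLinearMap ^ j)
            (ZetaValue.pairwise_commute_fieldDeriv (cycLevel p 0 r)
              (fun ℓ => modNCyclotomicCharacter ℚ (cycLevel p 0 r) (σ ℓ))
              (fun ℓ => ((primesEquiv ℓ : Nat.Primes) : ℕ) - 1) r))
            (x 0 ⟨r, hr⟩ + sigma (cycLevel p 0 r) (-1) (x 0 ⟨r, hr⟩)))) -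
          (((s * ((p : ℤ_[p]) - (aM p : ℤ_[p]) + 1) : ℤ_[p]) : ℚ_[p]) ⊗ₜ[ℚ]
            (1 : CyclotomicField (cycLevel p 0 r) ℚ)) =
        ((p : ℤ_[p]) ^ (j + 1)) • ∑ g : (ZMod (cycLevel p 0 r))ˣ,
          (((((p : MonoidAlgebra ℤ_[p] (ZMod (cycLevel p 0 r))ˣ)) -
              MonoidAlgebra.single v (aM p : ℤ_[p]) +
              MonoidAlgebra.single (v ^ 2) (1 : ℤ_[p])).coeff g : ℤ_[p]) : ℚ_[p]) •
            Algebra.TensorProduct.map (AlgHom.id ℚ ℚ_[p])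
              (sigma (cycLevel p 0 r) g : CyclotomicField (cycLevel p 0 r) ℚ →ₐ[ℚ]
                CyclotomicField (cycLevel p 0 r) ℚ) l) ∧
      haveI : NeZero (∏ q ∈ r, Ideal.absNorm q.asIdeal) :=
        ⟨Finset.prod_ne_zero_iff.2 fun q _ h => q.ne_bot (Ideal.absNorm_eq_zero_iff.1 h)⟩
      PadicInt.toZModPow (j + 1) s = (u : ZMod (p ^ (j + 1))) *
        ((p : ℕ) : ZMod (p ^ (j + 1))) ^ (0 : ℕ) *
          kuriharaNumber f (p ^ (j + 1)) (∏ q ∈ r, Ideal.absNorm q.asIdeal) ψ := by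
  classical
  -- the level `n = n(r)` and its primes
  have hprim : ∀ q ∈ r, ¬ ((primesEquiv q : Nat.Primes) : ℕ) ∣ 2 * c.natAbs * d.natAbs * A * N ∧
      ((primesEquiv q : Nat.Primes) : ℕ) ≠ p := fun q hq =>
    (mem_primes_cyclotomicLevelsRat_badPlaces_iff p c d A N q).mp (hr q hq)
  have hn : cycLevel p 0 r = ∏ q ∈ r, ((primesEquiv q : Nat.Primes) : ℕ) :=
    TameLevel.cycLevel_zero_eq_prod p r
  have hsq : Squarefree (cycLevel p 0 r) := TameLevel.squarefree_cycLevel_zero p r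
  have hnN : (cycLevel p 0 r).Coprime N := by
    rw [hn]
    exact Nat.Coprime.prod_left fun q hq => (Nat.Prime.coprime_iff_not_dvd (primesEquiv q).2).mpr
      fun h => (hprim q hq).1 (dvd_mul_of_dvd_right h _)
  have hncd : (cycLevel p 0 r).Coprime (c.natAbs * d.natAbs) := by
    rw [hn]
    exact Nat.Coprime.prod_left fun q hq => (Nat.Prime.coprime_iff_not_dvd (primesEquiv q).2).mpr
      fun h => (hprim q hq).1 (by
        obtain ⟨w, hw⟩ := h
        exact ⟨2 * A * N * w, by rw [show 2 * c.natAbs * d.natAbs * A * N =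
          (c.natAbs * d.natAbs) * (2 * A * N) by ring, hw]; ring⟩)
  have hM : (p * A).Coprime (cycLevel p 0 r) := by
    rw [hn]
    refine Nat.Coprime.prod_right fun q hq => Nat.Coprime.mul_left ?_ ?_
    · exact (Nat.coprime_primes Fact.out (primesEquiv q).2).mpr (hprim q hq).2.symm
    · exact ((Nat.Prime.coprime_iff_not_dvd (primesEquiv q).2).mpr fun h =>
        (hprim q hq).1 (dvd_mul_of_dvd_left (dvd_mul_of_dvd_right h _) _)).symm
  have hcdn : Int.gcd (c * d) (cycLevel p 0 r * A) = 1 := by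
    rw [Int.gcd_eq_natAbs] at hcd ⊢
    rw [Int.natAbs_mul] at hcd ⊢
    have h2 : ((cycLevel p 0 r : ℤ) * (A : ℤ)).natAbs = cycLevel p 0 r * A := by
      rw [Int.natAbs_mul, Int.natAbs_natCast, Int.natAbs_natCast]
    rw [Int.natAbs_natCast] at hcd
    rw [h2]
    exact Nat.Coprime.mul_right hncd.symm hcd
  -- R-κ (b)
  obtain ⟨uκ, huκ, hvu⟩ := hNorm
  have huκ0 : uκ ≠ 0 := by rintro rfl; exact hκ0 (by rw [← huκ, Rat.cast_zero])
  have huκ1 : ‖(uκ : ℚ_[p])‖ ≤ 1 := by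
    rw [Padic.norm_eq_zpow_neg_valuation (by exact_mod_cast huκ0), Padic.valuation_ratCast, hvu,
      neg_zero, zpow_zero]
  -- the embedding unit, the avatar, the units mod `n`
  obtain ⟨u, hι⟩ := CharSum.exists_units_apply_zeta_eq_exp (cycLevel p 0 r) (ι (cycLevel p 0 r))
  obtain ⟨X, hxX, -⟩ :=
    GroupRingEval.exists_unique_eq_sum_coeff_smul_sigma_zeta (cycLevel p 0 r) hsq (x 0 ⟨r, hr⟩)
  have hcu : IsUnit ((c : ℤ) : ZMod (cycLevel p 0 r)) := by
    rw [ZMod.coe_int_isUnit_iff_isCoprime, Int.isCoprime_iff_gcd_eq_one, Int.gcd_eq_natAbs,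
      Int.natAbs_natCast]
    exact Nat.Coprime.coprime_dvd_right (dvd_mul_right _ _) hncd
  have hdu : IsUnit ((d : ℤ) : ZMod (cycLevel p 0 r)) := by
    rw [ZMod.coe_int_isUnit_iff_isCoprime, Int.isCoprime_iff_gcd_eq_one, Int.gcd_eq_natAbs,
      Int.natAbs_natCast]
    exact Nat.Coprime.coprime_dvd_right (dvd_mul_left _ _) hncd
  let uq : ℕ → (ZMod (cycLevel p 0 r))ˣ := fun q =>
    if h : q.Coprime (cycLevel p 0 r) then ZMod.unitOfCoprime q h else 1
  have huq : ∀ q ∈ (p * A).primeFactors,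
      ((uq q : (ZMod (cycLevel p 0 r))ˣ) : ZMod (cycLevel p 0 r)) = q := by
    intro q hq
    have h : q.Coprime (cycLevel p 0 r) := Nat.Coprime.coprime_dvd_left (Nat.dvd_of_mem_primeFactors hq) hM
    simp only [uq, dif_pos h, ZMod.coe_unitOfCoprime]
  have hpmem : p ∈ (p * A).primeFactors := Nat.mem_primeFactors.mpr ⟨Fact.out, dvd_mul_right p A,
    mul_ne_zero (Fact.out : p.Prime).ne_zero (NeZero.ne A)⟩
  have hAsub : A.primeFactors ⊆ (p * A).primeFactors :=
    Nat.primeFactors_mono (dvd_mul_left A p) (mul_ne_zero (Fact.out : p.Prime).ne_zero (NeZero.ne A))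
  -- Kolyvagin depth
  have hK : ∀ q ∈ r, p ^ (j + 1) ∣ ((primesEquiv q : Nat.Primes) : ℕ) - 1 := fun q hq =>
    (Nat.modEq_iff_dvd' (primesEquiv q).2.one_lt.le).mp (hKol q hq).modEq_one.symm
  -- the integral structure `Θ₀` of `θ̃_f(n)` (Stevens integrality)
  obtain ⟨Θ₀, hΘ⟩ := exists_padicLift_modularElement f p (cycLevel p 0 r) fun b => by
    have h := hf.norm_ratPlusSymbol_div_le_one hp2 hirr hnN ((b : ZMod (cycLevel p 0 r)).val : ℤ)
    rwa [Int.cast_natCast] at h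
  -- the integral lift `V` of the twist WITHOUT its `p`-Euler factor (depletion modulus `A`), unit augmentation
  have hQ := hf.coeffField_eq_bot
  have hreal : ∀ m, (cuspCoeff f m).im = 0 := cuspCoeff_im_eq_zero_of_coeffField_eq_bot hQ
  have hAq : ∀ q ∈ A.primeFactors, q ≠ p := fun q hq h => hpA (h ▸ Nat.dvd_of_mem_primeFactors hq)
  have haq : ∀ q ∈ A.primeFactors, ‖((((aM q : ℚ) / q : ℚ)) : ℚ_[p])‖ ≤ 1 := fun q hq =>
    norm_ratCast_div_le_one_of_ne p (Nat.prime_of_mem_primeFactors hq) (hAq q hq) (aM q)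
  have hNq : ∀ q ∈ A.primeFactors, ‖(((if q ∣ N then 0 else (1 / q : ℚ)) : ℚ) : ℚ_[p])‖ ≤ 1 := by
    intro q hq
    by_cases hqN : q ∣ N
    · rw [if_pos hqN, Rat.cast_zero, norm_zero]; exact zero_le_one
    · rw [if_neg hqN]
      have h := norm_ratCast_div_le_one_of_ne p (Nat.prime_of_mem_primeFactors hq) (hAq q hq) 1
      rwa [Int.cast_one] at h
  have hsymb : ∀ m : ℤ, ‖((ratMinusSymbol f ((m : ℚ) / A) : ℚ) : ℚ_[p])‖ ≤ 1 := fun m =>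
    norm_ratMinusSymbol_le_one f hp2 hreal (coprime_den_of_coprime hAN m)
  obtain ⟨V, hV⟩ := exists_padicLift_twist p f u uκ A N uq aM _ rfl c d a d' A hcu.unit hdu.unit
    _ rfl _ rfl huκ1 haq hNq (hsymb a)
    (by have h := hsymb (a * c); rwa [Int.cast_mul] at h)
    (by have h := hsymb (a * d'); rwa [Int.cast_mul] at h)
    (by have h := hsymb (a * c * d'); rwa [Int.cast_mul, Int.cast_mul] at h)
  have hVu : IsUnit (∑ g : (ZMod (cycLevel p 0 r))ˣ, V.coeff g) :=
    isUnit_sum_coeff_twist_of_certificates p hp2 f u uκ A N uq aM _ rfl c d a d' A hcu.unit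
      hdu.unit _ rfl _ rfl V hV huκ0 hvu hE0 hE hR0 hR
  -- the `p`-Euler factor `P = p − a_pδ_v + δ_{v²}`, `v = [p]⁻¹`, and the factorisation `p • Vq = P_ℚ · Vq′`
  set v : (ZMod (cycLevel p 0 r))ˣ := (uq p)⁻¹ with hvdef
  have hv : (v : ZMod (cycLevel p 0 r)) * (p : ZMod (cycLevel p 0 r)) = 1 := by
    rw [hvdef, ← huq p hpmem, ← Units.val_mul, inv_mul_cancel, Units.val_one]
  set P : MonoidAlgebra ℤ_[p] (ZMod (cycLevel p 0 r))ˣ :=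
    (p : MonoidAlgebra ℤ_[p] (ZMod (cycLevel p 0 r))ˣ) - MonoidAlgebra.single v (aM p : ℤ_[p]) +
      MonoidAlgebra.single (v ^ 2) (1 : ℤ_[p]) with hPdef
  set Fp : MonoidAlgebra ℚ (ZMod (cycLevel p 0 r))ˣ :=
    1 - MonoidAlgebra.single (uq p)⁻¹ ((aM p : ℚ) / p) +
      MonoidAlgebra.single ((uq p)⁻¹ ^ 2) (if p ∣ N then 0 else (1 / p : ℚ)) with hFpdef
  have hp0 : (p : ℚ_[p]) ≠ 0 := Nat.cast_ne_zero.mpr (Fact.out : p.Prime).ne_zero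
  have hP : MonoidAlgebra.mapRingHom (ZMod (cycLevel p 0 r))ˣ (PadicInt.Coe.ringHom (p := p)) P =
      MonoidAlgebra.mapRingHom (ZMod (cycLevel p 0 r))ˣ (algebraMap ℚ ℚ_[p])
        (algebraMap ℚ _ (p : ℚ) * Fp) := by
    rw [hPdef, hFpdef, if_neg hpN, map_add, map_sub, map_natCast, MonoidAlgebra.mapRingHom_single,
      MonoidAlgebra.mapRingHom_single, map_intCast, map_one, map_mul,
      EulerFactorComparison.mapRingHom_algebraMap_algebraMap, map_add, map_sub, map_one,
      MonoidAlgebra.mapRingHom_single, MonoidAlgebra.mapRingHom_single, Rat.cast_natCast,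
      MonoidAlgebra.coe_algebraMap, Function.comp_apply, Algebra.algebraMap_self_apply, mul_add, mul_sub,
      mul_one, MonoidAlgebra.single_mul_single, MonoidAlgebra.single_mul_single, one_mul, one_mul,
      MonoidAlgebra.natCast_def, ← hvdef]
    congr 2
    · rw [eq_ratCast, Rat.cast_div, Rat.cast_intCast, Rat.cast_natCast, mul_div_cancel₀ _ hp0]
    · rw [eq_ratCast, Rat.cast_div, Rat.cast_one, Rat.cast_natCast, mul_one_div_cancel hp0]
  have hEq : (∏ q ∈ (p * A).primeFactors, (1 - MonoidAlgebra.single (uq q)⁻¹ ((aM q : ℚ) / q) +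
      MonoidAlgebra.single ((uq q)⁻¹ ^ 2) (if q ∣ N then 0 else (1 / q : ℚ)))) =
      Fp * ∏ q ∈ A.primeFactors, (1 - MonoidAlgebra.single (uq q)⁻¹ ((aM q : ℚ) / q) +
        MonoidAlgebra.single ((uq q)⁻¹ ^ 2) (if q ∣ N then 0 else (1 / q : ℚ))) := by
    have hpA' : (p * A).primeFactors = insert p A.primeFactors := by
      rw [Nat.primeFactors_mul (Fact.out : p.Prime).ne_zero (NeZero.ne A), (Fact.out : p.Prime).primeFactors,
        Finset.insert_eq]
    rw [hpA', Finset.prod_insert (fun h => hpA (Nat.dvd_of_mem_primeFactors h))]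
  have hfac : algebraMap ℚ _ (p : ℚ) *
      ((1 + MonoidAlgebra.single (-1 : (ZMod (cycLevel p 0 r))ˣ) (1 : ℚ)) * MonoidAlgebra.single u⁻¹ uκ *
        (∏ q ∈ (p * A).primeFactors, (1 - MonoidAlgebra.single (uq q)⁻¹ ((aM q : ℚ) / q) +
          MonoidAlgebra.single ((uq q)⁻¹ ^ 2) (if q ∣ N then 0 else (1 / q : ℚ)))) *
        (algebraMap ℚ _ ((c : ℚ) ^ 2 * (d : ℚ) ^ 2 * ratMinusSymbol f ((a : ℚ) / A)) -
          MonoidAlgebra.single hcu.unit ((c : ℚ) * (d : ℚ) ^ 2 * ratMinusSymbol f ((a * c : ℚ) / A)) -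
          MonoidAlgebra.single hdu.unit ((c : ℚ) ^ 2 * (d : ℚ) * ratMinusSymbol f ((a * d' : ℚ) / A)) +
          MonoidAlgebra.single (hcu.unit * hdu.unit)
            ((c : ℚ) * (d : ℚ) * ratMinusSymbol f ((a * c * d' : ℚ) / A)))) =
      (algebraMap ℚ _ (p : ℚ) * Fp) *
      ((1 + MonoidAlgebra.single (-1 : (ZMod (cycLevel p 0 r))ˣ) (1 : ℚ)) * MonoidAlgebra.single u⁻¹ uκ *
        (∏ q ∈ A.primeFactors, (1 - MonoidAlgebra.single (uq q)⁻¹ ((aM q : ℚ) / q) +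
          MonoidAlgebra.single ((uq q)⁻¹ ^ 2) (if q ∣ N then 0 else (1 / q : ℚ)))) *
        (algebraMap ℚ _ ((c : ℚ) ^ 2 * (d : ℚ) ^ 2 * ratMinusSymbol f ((a : ℚ) / A)) -
          MonoidAlgebra.single hcu.unit ((c : ℚ) * (d : ℚ) ^ 2 * ratMinusSymbol f ((a * c : ℚ) / A)) -
          MonoidAlgebra.single hdu.unit ((c : ℚ) ^ 2 * (d : ℚ) * ratMinusSymbol f ((a * d' : ℚ) / A)) +
          MonoidAlgebra.single (hcu.unit * hdu.unit)
            ((c : ℚ) * (d : ℚ) * ratMinusSymbol f ((a * c * d' : ℚ) / A)))) := by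
    rw [hEq]; ring
  -- the seat's FACTORED derivative congruence at `b := χ_n ∘ σ`
  have hcmp := KimAtThreeShallowEqDeepAnomalousCongruenceOfZetaBody.prod_deriv_mul_plusAvatar_sub_eq_factor_mul_of_zetaBody
    hbody hf hp2 hirr ⟨r, hr⟩ d' hcdn hdd' uκ huκ u hι X hxX
    (fun q => modNCyclotomicCharacter ℚ (cycLevel p 0 r) (σ q))
    (fun q _ ℓ' hℓ' hne => unitsMap_modNCyclotomicCharacter_eq_one_of_mem_inertia p σ hσI r q hℓ' hne)
    uq huq aM haM _ rfl hcu.unit hdu.unit hcu.unit_spec hdu.unit_spec _ rfl _ rfl (j + 1) hK Θ₀ hΘ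
    (p : ℚ) _ _ hfac P V hP hV
  -- the seat's twisted T-PK6-VROW ★★
  obtain ⟨s, w, ψ, hψ, hval, hw⟩ :=
    KimAtThreeShallowEqDeepAnomalousValueRow.exists_valueRow_twist_of_factor_mul p f hp2 hf hirr j σ η hσI
      hσχ r hη hKol (x 0 ⟨r, hr⟩) X hxX Θ₀ hΘ V hVu P hcmp
  refine ⟨v, hv, s, w, ψ, hψ, ?_, hw⟩
  -- the augmentation of `P` is `p − a_p + 1 = #Ẽ(𝔽_p)`
  have hsumP : ∑ g : (ZMod (cycLevel p 0 r))ˣ, P.coeff g = (p : ℤ_[p]) - (aM p : ℤ_[p]) + 1 := by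
    rw [hPdef, sum_coeff_add, sum_coeff_sub, MonoidAlgebra.natCast_def, ValueRow.sum_coeff_single,
      ValueRow.sum_coeff_single, ValueRow.sum_coeff_single]
  obtain ⟨l, hl, h⟩ := hval
  refine ⟨l, hl, ?_⟩
  rw [← hsumP, h]

end Main

end Summit.BirchSwinnertonDyer.BirchSwinnertonDyer.Theorems.KimAtThreeShallowEqDeepAnomalousValueRowsOfZetaBody

end
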